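import Literature.Computation.Certificates.CliqueSumSparseCheck
import Mathlib.Data.Matrix.Block
import Mathlib.Data.List.GetD
import Mathlib.Logic.Equiv.Fin.Basic
import HarnessLib

/-!
# Sparse matrix algebra for kernel identity checks (CRS row lists; radix grouping; O(nnz log N))

Compute-infrastructure companion of `CliqueSumSparseCheck.lean` (sparse rows `PSD.SRow`, the matrix
`PSD.matrixOfSparseRows` of a row list). A certificate's second exact identity — «the model's
matrix expression (products, transposes, diagonal scalings, block assembly of the typed model
matrices) EQUALS the literal matrix the PSD certificate is about» (e.g. `−𝓛(P, τ, λ, …) = Aq` for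
a Lur'e–Postnikov LMI) — is decided entrywise in the instance files written so far (`N²` entries,
each a sum over an inner dimension: measured 47 s per row for dense `58 × 58` products,
gridfusion-model-2 2026-08-27, and still `N²` lookups after contracting over nonzeros). This file
evaluates such expressions on SPARSE ROW LISTS (`SMat R = List (SRow R)`, Compressed Row Storage
[cite: BarrettEtAl1994, §4.3.1 «Compressed Row Storage (CRS)», p. 57]) with laws stated against
`matrixOfSparseRows`, so that the identity becomes ONE row-by-row residual test:

* row-local operations: `SMat.add` / `sub` / `neg` / `smul` (zipped merges), `SMat.diagonal` / `scalar`,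
  `SMat.ofDense`, `SMat.ofFn` (tabulate a typed matrix function), `SMat.scaleRows` (`diagonal d * A`), `SMat.hcat` / `vcat` / `fromBlocks` (block assembly, law against
  `Matrix.fromBlocks` re-indexed by `finSumFinEquiv`);
* ONE global primitive, **radix grouping** `radix d lo ps` of keyed packets into `2^d` consecutive
  key buckets (cost `P · d`; law `radix_eq`: bucket `t` IS the sub-list of packets with key
  `lo + t`, in order — no sorting, no permutation argument, keys out of range simply never match);
  on it: `SMat.transpose` (entries re-keyed by column) and the transposed product
  `SMat.mulT At B = Atᵀ * B` (outer products `Σ_k (row k of At)ᵀ ⊗ (row k of B)` re-keyed by output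
  row) — the natural primitive of LMI expressions (`AᵀP`, `CᵀΛC`), with `A * B = mulT (transpose A) B`;
  no operation ever performs a positional row access inside a loop (the `O(N)`-per-access trap of
  list-backed matrices), so every cost is `O(nnz · log N)` or `O(flops)`;
* the checker `SMat.eqCheck m A B` (first `m` rows, residual `subMerge` + `isZeroRow`) with
  `matrixOfSparseRows_eq_of_eqCheck`.

MEASURED (farm `decide +kernel`, 2026-08-27, on the `354`-state synthetic structure-preserving object
of gridfusion-sos-4's SPSYN-R236 certificate; `nnz(A) = 236`, `nnz(P) = 1534`): `eqCheck` of
`P * A` 15 s, of `Aᵀ P + P A` 18 s, of `P * P` (`nnz 2714`) 25 s, of `(Aᵀ)ᵀ` against `A` 8 s —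
file walls including the elaboration of the literals; i.e. the model-side identity of an
SP-118-class LMI is minutes of kernel in a few files, not the `N² ·` inner-dimension hours of the
entrywise route.

USAGE (model-side identity of a certificate; `Aq` the certificate's literal as sparse rows):
```
-- the typed model matrices as sparse literals (or `SMat.ofDense` of dense literals)
def sA : PSD.SMat ℚ := [[(0, a₀₀), (3, a₀₃)], …]     -- A, n × n
def sP : PSD.SMat ℚ := …                              -- P
-- −𝓛₁₁ = −(AᵀP + PA + ε·1): build it with the operations of this file
def negL11 : PSD.SMat ℚ :=
  SMat.neg (SMat.add (SMat.add (SMat.mulT d n sA sP) (SMat.mul d d n n sP sA))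
    (SMat.diagonal (List.replicate n ε)))
theorem chk : SMat.eqCheck n negL11 aqRows = true := by decide +kernel
-- then `matrixOfSparseRows n n negL11 = matrixOfSparseRows n n aqRows` by
-- `SMat.matrixOfSparseRows_eq_of_eqCheck`, and the left side rewrites to
-- `−((matrixOfSparseRows n n sA)ᵀ * P' + P' * A' + …)` by the `matrixOfSparseRows_*` laws.
```
ROW-WINDOW PRESENTATION of a large typed object (`matrixOfSparseRows_eq_of_eqCheck_windows`,
`of_eq_matrixOfSparseRows_of_eqCheck_windows`): at `n ≳ 150` one `eqCheck n (ofFn n n f) sX` of a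
function-typed model matrix against its row literal is `n²` evaluations and does not finish in one
decide (MEASURED, gridfusion lit-5 2026-08-27: `n = 354`, ≈ 4 non-zeros per row); window `t` decides
`eqCheck len ((ofFn n n f).drop (t·len)) (sX.drop (t·len)) = true` in its own file (the dropped rows
are never evaluated; 118 rows ≈ 84 s) and the windows assemble into `Matrix.of f = matrixOfSparseRows n n sX`.
Semantics are unconditional in the row data (duplicate / unsorted columns are summed by `SRow.fn`);
dimension arguments only say which rows/columns the `Fin`-indexed matrix reads, and the laws drop
out-of-range keys explicitly (`takeCols`, `take`). Everything is structural recursion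
(`decide +kernel`). [cite: BarrettEtAl1994, §4.3.1, p. 57] for the storage scheme and the row-wise
traversal («the CRS format … needs an indirect addressing step for every single scalar operation in a
matrix-vector product») and §4.3.2 pp. 61–62 for the row-wise product and the transpose product by
index switching (the scatter loop `y(col_ind(i)) += val(i)·x(j)` is `mulT`'s packet emission);
[cite: CormenEtAl2001, §8.3 Lemma 8.3, p. 172] for distribution (radix) sorting by binary digits; the
algebraic laws restate the `Matrix` operations of Mathlib that the row-list operations implement.
-/

namespace Literature.Computation.Certificates

namespace PSD

open Matrix

variable {R : Type*}

/-! ## More sparse-row utilities -/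

namespace SRow

section Monoid

variable [AddCommMonoid R]

/-- `fn` is additive over concatenation of rows. [cite: BarrettEtAl1994, §4.3.1, p. 57] -/
theorem fn_append (r s : SRow R) (j : ℕ) : fn (r ++ s) j = fn r j + fn s j := by
  induction r with
  | nil => simp
  | cons p r ih =>
    obtain ⟨j', v⟩ := p
    rw [List.cons_append, fn_cons, fn_cons, ih, add_assoc]

/-- `fn` of a flattened list of rows. [cite: BarrettEtAl1994, §4.3.1, p. 57] -/
theorem fn_flatten (rs : List (SRow R)) (j : ℕ) :
    fn rs.flatten j = (rs.map fun r => fn r j).sum := by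
  induction rs with
  | nil => rfl
  | cons r rs ih => rw [List.flatten_cons, fn_append, ih, List.map_cons, List.sum_cons]

/-- `fn` of a row built by `map` from packets `(key, value)` (general form of `fn_map`).
[cite: BarrettEtAl1994, §4.3.1, p. 57] -/
theorem fn_map_pair {α : Type*} (L : List α) (f : α → ℕ × R) (j : ℕ) :
    fn (L.map f) j = (L.map fun x => if (f x).1 = j then (f x).2 else 0).sum := by
  induction L with
  | nil => rfl
  | cons x L ih =>
    rw [List.map_cons, List.map_cons, List.sum_cons, ← ih]
    rcases f x with ⟨a, b⟩
    rfl

/-- Keep the columns `< n` (what an `n`-column matrix reads). [cite: BarrettEtAl1994, §4.3.1, p. 57] -/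
def takeCols (n : ℕ) (r : SRow R) : SRow R := r.filter fun p => decide (p.1 < n)

/-- Law of `takeCols`. [cite: BarrettEtAl1994, §4.3.1, p. 57] -/
theorem fn_takeCols (n : ℕ) (r : SRow R) (j : ℕ) :
    fn (takeCols n r) j = if j < n then fn r j else 0 := by
  induction r with
  | nil => simp [takeCols]
  | cons p r ih =>
    obtain ⟨j', v⟩ := p
    have ih' : fn (takeCols n r) j = if j < n then fn r j else 0 := ih
    simp only [takeCols, List.filter_cons] at ih' ⊢
    by_cases h : j' < n
    · simp only [h, decide_true, if_true, fn_cons, ih']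
      by_cases hj : j' = j
      · subst hj; simp [h]
      · simp [hj]
    · simp only [h, decide_false, Bool.false_eq_true, if_false, ih', fn_cons]
      by_cases hj : j' = j
      · subst hj; simp [h]
      · simp [hj]

/-- Shift all columns by `n` (placing a block to the right of an `n`-column block).
[cite: BarrettEtAl1994, §4.3.1, p. 57] -/
def shift (n : ℕ) (r : SRow R) : SRow R := r.map fun p => (p.1 + n, p.2)

/-- Law of `shift`. [cite: BarrettEtAl1994, §4.3.1, p. 57] -/
theorem fn_shift (n : ℕ) (r : SRow R) (j : ℕ) :
    fn (shift n r) j = if n ≤ j then fn r (j - n) else 0 := by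
  induction r with
  | nil => simp [shift]
  | cons p r ih =>
    obtain ⟨j', v⟩ := p
    have ih' : fn (shift n r) j = if n ≤ j then fn r (j - n) else 0 := ih
    simp only [shift, List.map_cons] at ih' ⊢
    rw [fn_cons, ih', fn_cons]
    by_cases hn : n ≤ j
    · rw [if_pos hn, if_pos hn]
      by_cases hj : j' + n = j
      · rw [if_pos hj, if_pos (by omega)]
      · rw [if_neg hj, if_neg (by omega)]
    · have h1 : ¬(j' + n = j) := by omega
      rw [if_neg hn, if_neg hn, if_neg h1, zero_add]

end Monoid

section Semiring

variable [Semiring R]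

/-- Scale a row. [cite: BarrettEtAl1994, §4.3.1, p. 57] -/
def scale (c : R) (r : SRow R) : SRow R := r.map fun p => (p.1, c * p.2)

/-- Law of `scale`. [cite: BarrettEtAl1994, §4.3.1, p. 57] -/
theorem fn_scale (c : R) (r : SRow R) (j : ℕ) : fn (scale c r) j = c * fn r j := by
  induction r with
  | nil => simp [scale]
  | cons p r ih =>
    obtain ⟨j', v⟩ := p
    have ih' : fn (scale c r) j = c * fn r j := ih
    simp only [scale, List.map_cons] at ih' ⊢
    rw [fn_cons, ih', fn_cons, mul_add, mul_ite, mul_zero]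

end Semiring

section AddMerge

variable [AddCommMonoid R]

/-- One step of the **merge-addition** of a column-sorted row into a column-sorted row (structural
in the row; continuation-passing as `subMergeAux`). [cite: BarrettEtAl1994, §4.3.1, p. 57] -/
def addMergeAux (j' : ℕ) (v : R) (rest : SRow R → SRow R) : SRow R → SRow R
  | [] => (j', v) :: rest []
  | (j, w) :: row =>
    if j' < j then (j', v) :: rest ((j, w) :: row)
    else if j' = j then (j, w + v) :: rest row
    else (j, w) :: addMergeAux j' v rest row

/-- **Merge-add** `pk` into `row` (one pass when both are sorted by column). Law unconditional.
[cite: BarrettEtAl1994, §4.3.1, p. 57] -/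
def addMerge : SRow R → SRow R → SRow R
  | [] => id
  | (j', v) :: pk => addMergeAux j' v (addMerge pk)

/-- Law of `addMergeAux`, given the law of its continuation. [cite: BarrettEtAl1994, §4.3.1, p. 57] -/
theorem fn_addMergeAux (j' : ℕ) (v : R) {rest : SRow R → SRow R} {j₀ : ℕ} {g : R}
    (hrest : ∀ row, fn (rest row) j₀ = fn row j₀ + g) (row : SRow R) :
    fn (addMergeAux j' v rest row) j₀ = fn row j₀ + ((if j' = j₀ then v else 0) + g) := by
  induction row with
  | nil =>
    rw [addMergeAux, fn_cons, hrest, fn_nil]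
    abel
  | cons p row ih =>
    obtain ⟨j, w⟩ := p
    rw [addMergeAux]
    by_cases h1 : j' < j
    · rw [if_pos h1, fn_cons, hrest, fn_cons]
      by_cases h : j' = j₀
      · simp only [if_pos h]; abel
      · simp only [if_neg h]; abel
    · rw [if_neg h1]
      by_cases h2 : j' = j
      · subst h2
        rw [if_pos rfl, fn_cons, hrest, fn_cons]
        by_cases h : j' = j₀
        · simp only [if_pos h]; abel
        · simp only [if_neg h]; abel
      · rw [if_neg h2, fn_cons, ih, fn_cons]
        abel

/-- **Law of `addMerge`**: `fn (addMerge pk row) = fn row + fn pk`. [cite: BarrettEtAl1994, §4.3.1, p. 57] -/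
theorem fn_addMerge (pk : SRow R) (j₀ : ℕ) (row : SRow R) :
    fn (addMerge pk row) j₀ = fn row j₀ + fn pk j₀ := by
  induction pk generalizing row with
  | nil => simp [addMerge]
  | cons p pk ih =>
    obtain ⟨j', v⟩ := p
    rw [addMerge, fn_addMergeAux j' v ih, fn_cons]

/-- Sum a list of rows by successive merges. [cite: BarrettEtAl1994, §4.3.1, p. 57] -/
def sumRows : List (SRow R) → SRow R
  | [] => []
  | r :: rs => addMerge r (sumRows rs)

/-- Law of `sumRows`. [cite: BarrettEtAl1994, §4.3.1, p. 57] -/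
theorem fn_sumRows (rs : List (SRow R)) (j : ℕ) :
    fn (sumRows rs) j = (rs.map fun r => fn r j).sum := by
  induction rs with
  | nil => rfl
  | cons r rs ih => rw [sumRows, fn_addMerge, ih, List.map_cons, List.sum_cons, add_comm]

end AddMerge

end SRow

/-! ## Radix grouping of keyed packets (the only global operation) -/

section Radix

variable {α : Type*}

/-- **Radix grouping**: distribute the packets `(key, payload)` into `2 ^ d` consecutive buckets
for the keys `lo, lo + 1, …, lo + 2^d − 1` by `d` binary splits (cost `|ps| · d`; payload order
preserved inside a bucket; keys outside the range land nowhere). [cite: CormenEtAl2001, §8.3 «Radix sort», Lemma 8.3, p. 172] -/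
def radix : ℕ → ℕ → List (ℕ × α) → List (List α)
  | 0, lo, ps => [(ps.filter fun p => decide (p.1 = lo)).map Prod.snd]
  | d + 1, lo, ps =>
    radix d lo (ps.filter fun p => decide (p.1 < lo + 2 ^ d)) ++
      radix d (lo + 2 ^ d) (ps.filter fun p => decide (lo + 2 ^ d ≤ p.1))

/-- **Law of radix grouping**: bucket `t` is exactly the sub-list of packets with key `lo + t`.
[cite: CormenEtAl2001, §8.3 «Radix sort», Lemma 8.3, p. 172] -/
theorem radix_eq (d lo : ℕ) (ps : List (ℕ × α)) :
    radix d lo ps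
      = (List.range (2 ^ d)).map fun t => (ps.filter fun p => decide (p.1 = lo + t)).map Prod.snd := by
  induction d generalizing lo ps with
  | zero => simp [radix]
  | succ d ih =>
    rw [radix, ih, ih, pow_succ, mul_two, List.range_add, List.map_append, List.map_map]
    congr 1
    · refine List.map_congr_left fun t ht => ?_
      rw [List.mem_range] at ht
      rw [List.filter_filter]
      congr 1
      refine List.filter_congr fun p _ => ?_
      by_cases h : p.1 = lo + t
      · simp [h, ht]
      · simp [h]
    · refine List.map_congr_left fun t _ => ?_
      rw [Function.comp_apply, List.filter_filter]
      congr 1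
      refine List.filter_congr fun p _ => ?_
      by_cases h : p.1 = lo + 2 ^ d + t
      · simp [h, Nat.add_assoc]
      · have h' : ¬p.1 = lo + (2 ^ d + t) := by rwa [← Nat.add_assoc]
        simp [h, h']

/-- `radix` has exactly `2 ^ d` buckets. [cite: CormenEtAl2001, §8.3 «Radix sort», Lemma 8.3, p. 172] -/
theorem length_radix (d lo : ℕ) (ps : List (ℕ × α)) : (radix d lo ps).length = 2 ^ d := by
  rw [radix_eq, List.length_map, List.length_range]

/-- Bucket `t < 2^d` of `radix`. [cite: CormenEtAl2001, §8.3 «Radix sort», Lemma 8.3, p. 172] -/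
theorem getD_radix (d lo : ℕ) (ps : List (ℕ × α)) {t : ℕ} (ht : t < 2 ^ d) :
    (radix d lo ps).getD t [] = (ps.filter fun p => decide (p.1 = lo + t)).map Prod.snd := by
  rw [radix_eq, List.getD_eq_getElem?_getD, List.getElem?_map, List.getElem?_range ht]
  rfl

end Radix

/-! ## Sparse matrices: row lists -/

/-- A **sparse matrix** in Compressed Row Storage: the list of its sparse rows (row `i` = `A[i]`,
empty past the end); read as a `Fin m × Fin n` matrix by `matrixOfSparseRows m n`.
[cite: BarrettEtAl1994, §4.3.1 «Compressed Row Storage (CRS)», p. 57] -/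
abbrev SMat (R : Type*) := List (SRow R)

namespace SMat

/-! ### Row-local operations -/

section Zip

variable [AddCommMonoid R]

/-- Zip two row lists with a row operation, padding the shorter with empty rows. [folklore] -/
def zipRows (f : SRow R → SRow R → SRow R) : SMat R → SMat R → SMat R
  | [], B => B.map (f [])
  | a :: A, [] => (a :: A).map fun r => f r []
  | a :: A, b :: B => f a b :: zipRows f A B

omit [AddCommMonoid R] in
/-- Rows of a zip. [folklore] -/
private theorem getD_zipRows {f : SRow R → SRow R → SRow R} (hf : f [] [] = []) :
    ∀ (A B : SMat R) (i : ℕ), (zipRows f A B).getD i [] = f (A.getD i []) (B.getD i []) := by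
  intro A
  induction A with
  | nil =>
    intro B i
    rw [zipRows, List.getD_eq_getElem?_getD, List.getElem?_map, List.getD_nil]
    cases h : B[i]? with
    | none => simp [List.getD_eq_getElem?_getD, h, hf]
    | some b => simp [List.getD_eq_getElem?_getD, h]
  | cons a A ih =>
    intro B i
    cases B with
    | nil =>
      rw [zipRows, List.getD_eq_getElem?_getD, List.getElem?_map, List.getD_nil]
      cases h : (a :: A)[i]? with
      | none => simp [List.getD_eq_getElem?_getD, h, hf]
      | some r => simp [List.getD_eq_getElem?_getD, h]
    | cons b B =>
      rw [zipRows]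
      cases i with
      | zero => simp
      | succ i => simp only [List.getD_cons_succ]; exact ih B i

/-- **Sum** of sparse matrices (row-wise merge). [cite: BarrettEtAl1994, §4.3.1 «Compressed Row Storage (CRS)», p. 57] -/
def add (A B : SMat R) : SMat R := zipRows (fun a b => SRow.addMerge b a) A B

/-- Law of `add`. [cite: BarrettEtAl1994, §4.3.1 «Compressed Row Storage (CRS)», p. 57] -/
theorem matrixOfSparseRows_add (m n : ℕ) (A B : SMat R) :
    matrixOfSparseRows m n (add A B) = matrixOfSparseRows m n A + matrixOfSparseRows m n B := by
  ext i j
  rw [Matrix.add_apply, matrixOfSparseRows_apply, matrixOfSparseRows_apply,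
    matrixOfSparseRows_apply, add, getD_zipRows (by rfl), SRow.fn_addMerge]

end Zip

section Ring

variable [CommRing R]

/-- **Scalar multiple**. [cite: BarrettEtAl1994, §4.3.1 «Compressed Row Storage (CRS)», p. 57] -/
def smul (c : R) (A : SMat R) : SMat R := A.map (SRow.scale c)

/-- Law of `smul`. [cite: BarrettEtAl1994, §4.3.1 «Compressed Row Storage (CRS)», p. 57] -/
theorem matrixOfSparseRows_smul (m n : ℕ) (c : R) (A : SMat R) :
    matrixOfSparseRows m n (smul c A) = c • matrixOfSparseRows m n A := by
  ext i j
  rw [Matrix.smul_apply, matrixOfSparseRows_apply, matrixOfSparseRows_apply, smul,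
    List.getD_eq_getElem?_getD, List.getElem?_map, smul_eq_mul]
  cases h : A[i.val]? with
  | none => simp [List.getD_eq_getElem?_getD, h]
  | some r => simp [List.getD_eq_getElem?_getD, h, SRow.fn_scale]

/-- **Negation**. [cite: BarrettEtAl1994, §4.3.1 «Compressed Row Storage (CRS)», p. 57] -/
def neg (A : SMat R) : SMat R := smul (-1) A

/-- Law of `neg`. [cite: BarrettEtAl1994, §4.3.1 «Compressed Row Storage (CRS)», p. 57] -/
theorem matrixOfSparseRows_neg (m n : ℕ) (A : SMat R) :
    matrixOfSparseRows m n (neg A) = -matrixOfSparseRows m n A := by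
  rw [neg, matrixOfSparseRows_smul, neg_one_smul]

/-- **Difference** (row-wise merge-subtraction). [cite: BarrettEtAl1994, §4.3.1 «Compressed Row Storage (CRS)», p. 57] -/
def sub (A B : SMat R) : SMat R := zipRows (fun a b => SRow.subMerge b a) A B

/-- Law of `sub`. [cite: BarrettEtAl1994, §4.3.1 «Compressed Row Storage (CRS)», p. 57] -/
theorem matrixOfSparseRows_sub (m n : ℕ) (A B : SMat R) :
    matrixOfSparseRows m n (sub A B) = matrixOfSparseRows m n A - matrixOfSparseRows m n B := by
  ext i j
  rw [Matrix.sub_apply, matrixOfSparseRows_apply, matrixOfSparseRows_apply,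
    matrixOfSparseRows_apply, sub, getD_zipRows (by rfl), SRow.fn_subMerge]

/-- **Diagonal matrix** from the list of diagonal entries (starting at row/column `i`). [cite: BarrettEtAl1994, §4.3.1 «Compressed Row Storage (CRS)», p. 57] -/
def diagonalFrom : ℕ → List R → SMat R
  | _, [] => []
  | i, x :: d => [(i, x)] :: diagonalFrom (i + 1) d

omit [CommRing R] in
/-- Rows of `diagonalFrom`. [folklore] -/
private theorem getD_diagonalFrom (d : List R) (i₀ i : ℕ) :
    (diagonalFrom i₀ d).getD i [] = match d[i]? with | some x => [(i₀ + i, x)] | none => [] := by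
  induction d generalizing i₀ i with
  | nil => simp [diagonalFrom]
  | cons x d ih =>
    rw [diagonalFrom]
    cases i with
    | zero => simp
    | succ i =>
      rw [List.getD_cons_succ, ih, List.getElem?_cons_succ, Nat.add_right_comm i₀ 1 i]
      rfl

/-- **Diagonal matrix** `diagonal [d₀, d₁, …]`. [cite: BarrettEtAl1994, §4.3.1 «Compressed Row Storage (CRS)», p. 57] -/
def diagonal (d : List R) : SMat R := diagonalFrom 0 d

/-- Law of `diagonal`: `Matrix.diagonal (fun i => d[i] or 0)`. [cite: BarrettEtAl1994, §4.3.1 «Compressed Row Storage (CRS)», p. 57] -/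
theorem matrixOfSparseRows_diagonal (n : ℕ) (d : List R) :
    matrixOfSparseRows n n (diagonal d) = Matrix.diagonal fun i : Fin n => d.getD i.val 0 := by
  ext i j
  rw [matrixOfSparseRows_apply, diagonal, getD_diagonalFrom, Matrix.diagonal_apply,
    List.getD_eq_getElem?_getD]
  cases h : d[i.val]? with
  | none =>
    simp only [Option.getD_none, SRow.fn_nil]
    split_ifs <;> rfl
  | some x =>
    simp only [Nat.zero_add, SRow.fn_cons, SRow.fn_nil, add_zero, Option.getD_some, Fin.ext_iff]

/-- **Row scaling** `diagonal d * A`: row `i` scaled by `d[i]` (zip with the list `d`; `O(nnz)`).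
Column scaling `A * diagonal d` is `transpose (scaleRows d (transpose A))`. [cite: BarrettEtAl1994, §4.3.1 «Compressed Row Storage (CRS)», p. 57] -/
def scaleRows : List R → SMat R → SMat R
  | [], _ => []
  | _ :: _, [] => []
  | c :: d, r :: A => SRow.scale c r :: scaleRows d A

/-- Rows of `scaleRows` (plumbing). [folklore] -/
private theorem fn_scaleRows : ∀ (d : List R) (A : SMat R) (i j : ℕ),
    SRow.fn ((scaleRows d A).getD i []) j = d.getD i 0 * SRow.fn (A.getD i []) j
  | [], A, i, j => by simp [scaleRows]
  | c :: d, [], i, j => by cases i <;> simp [scaleRows]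
  | c :: d, r :: A, 0, j => by simp [scaleRows, SRow.fn_scale]
  | c :: d, r :: A, i + 1, j => by
    rw [scaleRows, List.getD_cons_succ, fn_scaleRows d A i j, List.getD_cons_succ,
      List.getD_cons_succ]

/-- Law of `scaleRows`: `Matrix.diagonal (fun i => d[i] or 0) * A`. [cite: BarrettEtAl1994, §4.3.1 «Compressed Row Storage (CRS)», p. 57] -/
theorem matrixOfSparseRows_scaleRows (m n : ℕ) (d : List R) (A : SMat R) :
    matrixOfSparseRows m n (scaleRows d A)
      = Matrix.diagonal (fun i : Fin m => d.getD i.val 0) * matrixOfSparseRows m n A := by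
  ext i j
  rw [Matrix.diagonal_mul, matrixOfSparseRows_apply, matrixOfSparseRows_apply, fn_scaleRows]

/-- **Scalar matrix** `c • 1` of size `n` (as `diagonal (replicate n c)`). [cite: BarrettEtAl1994, §4.3.1 «Compressed Row Storage (CRS)», p. 57] -/
def scalar (n : ℕ) (c : R) : SMat R := diagonal (List.replicate n c)

/-- Law of `scalar`: `c • 1`. [cite: BarrettEtAl1994, §4.3.1 «Compressed Row Storage (CRS)», p. 57] -/
theorem matrixOfSparseRows_scalar (n : ℕ) (c : R) :
    matrixOfSparseRows n n (scalar n c) = c • (1 : Matrix (Fin n) (Fin n) R) := by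
  rw [scalar, matrixOfSparseRows_diagonal]
  ext i j
  rw [Matrix.diagonal_apply, Matrix.smul_apply, Matrix.one_apply, smul_eq_mul, mul_ite, mul_one,
    mul_zero, List.getD_eq_getElem?_getD, List.getElem?_replicate, if_pos i.isLt, Option.getD_some]

/-- **Dense rows read as a sparse matrix** (zeros dropped). [cite: BarrettEtAl1994, §4.3.1 «Compressed Row Storage (CRS)», p. 57] -/
def ofDense [DecidableEq R] (rows : List (List R)) : SMat R := rows.map (SRow.ofDense 0)

/-- Law of `ofDense`: the dense literal `matrixOfRows`. [cite: BarrettEtAl1994, §4.3.1 «Compressed Row Storage (CRS)», p. 57] -/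
theorem matrixOfSparseRows_ofDense [DecidableEq R] (m n : ℕ) (rows : List (List R)) :
    matrixOfSparseRows m n (ofDense rows) = matrixOfRows m n rows := by
  ext i j
  rw [matrixOfSparseRows_apply, matrixOfRows_apply, ofDense, List.getD_eq_getElem?_getD,
    List.getElem?_map]
  cases h : rows[i.val]? with
  | none => simp [List.getD_eq_getElem?_getD, h]
  | some r => simp [List.getD_eq_getElem?_getD, h]

/-- **A matrix given as a function**, tabulated into sparse rows (`m · n` evaluations; for
comparing a typed model matrix with a certificate's literal by `eqCheck`). [cite: BarrettEtAl1994, §4.3.1 «Compressed Row Storage (CRS)», p. 57] -/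
def ofFn [DecidableEq R] (m n : ℕ) (f : Fin m → Fin n → R) : SMat R :=
  (List.finRange m).map fun i => SRow.ofDense 0 ((List.finRange n).map (f i))

/-- Law of `ofFn`: the tabulated matrix is `f`. [cite: BarrettEtAl1994, §4.3.1 «Compressed Row Storage (CRS)», p. 57] -/
theorem matrixOfSparseRows_ofFn [DecidableEq R] (m n : ℕ) (f : Fin m → Fin n → R) :
    matrixOfSparseRows m n (ofFn m n f) = Matrix.of f := by
  ext i j
  rw [matrixOfSparseRows_apply, Matrix.of_apply, ofFn, List.getD_eq_getElem?_getD,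
    List.getElem?_map, List.getElem?_eq_getElem (by simp), List.getElem_finRange]
  simp only [Option.map_some, Option.getD_some, SRow.fn_ofDense_zero]
  rw [List.getD_eq_getElem?_getD, List.getElem?_map, List.getElem?_eq_getElem (by simp),
    List.getElem_finRange]
  simp

end Ring

/-! ### The equality checker -/

section Check

variable [AddCommGroup R] [DecidableEq R]

/-- Compare the first `m` rows: every residual row `A[i] − B[i]` passes `isZeroRow`. [cite: BarrettEtAl1994, §4.3.1 «Compressed Row Storage (CRS)», p. 57] -/
def eqCheck : ℕ → SMat R → SMat R → Bool
  | 0, _, _ => true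
  | m + 1, A, B =>
    (SRow.subMerge (B.headD []) (A.headD [])).isZeroRow && eqCheck m A.tail B.tail

/-- Soundness of `eqCheck` on rows. [folklore] -/
private theorem fn_eq_of_eqCheck : ∀ {m : ℕ} {A B : SMat R}, eqCheck m A B = true →
    ∀ i, i < m → ∀ j, SRow.fn (A.getD i []) j = SRow.fn (B.getD i []) j
  | 0, _, _, _, i, hi, _ => absurd hi (Nat.not_lt_zero i)
  | m + 1, A, B, h, i, hi, j => by
    rw [eqCheck, Bool.and_eq_true] at h
    cases i with
    | zero =>
      have hz := SRow.fn_eq_zero_of_isZeroRow h.1 j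
      rw [SRow.fn_subMerge, sub_eq_zero] at hz
      cases A <;> cases B <;> simp_all
    | succ i =>
      have ih := fn_eq_of_eqCheck h.2 i (by omega) j
      cases A <;> cases B <;> simp_all

/-- **Soundness of the equality checker**: the two row lists are the same `Fin m × Fin n` matrix.
[cite: BarrettEtAl1994, §4.3.1 «Compressed Row Storage (CRS)», p. 57] -/
theorem matrixOfSparseRows_eq_of_eqCheck {m : ℕ} (n : ℕ) {A B : SMat R}
    (h : eqCheck m A B = true) : matrixOfSparseRows m n A = matrixOfSparseRows m n B :=
  Matrix.ext fun i j => fn_eq_of_eqCheck h i.val i.isLt j.val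

omit [AddCommGroup R] [DecidableEq R] in
/-- Dropping `s` rows and reading row `r − s` reads row `r` (plumbing). [folklore] -/
private theorem getD_drop_sub (L : SMat R) {s r : ℕ} (hs : s ≤ r) :
    (L.drop s).getD (r - s) [] = L.getD r [] := by
  rw [List.getD_eq_getElem?_getD, List.getD_eq_getElem?_getD, List.getElem?_drop,
    Nat.add_sub_cancel' hs]

/-- **Row-window form of the equality checker** — the PRESENTATION of a large typed object in `k`
files: window `t` decides `eqCheck len (A.drop (t·len)) (B.drop (t·len)) = true` (`t : Fin k`,
`m ≤ k·len`; the dropped rows of a lazily tabulated `A = SMat.ofFn m n f` are never evaluated, so a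
window costs `len·n` evaluations of `f`), and the windows assemble into the matrix identity (supply
them as `fun t => by fin_cases t <;> [exact pw₀; exact pw₁; …]`). MEASURED (farm, 2026-08-27,
gridfusion lit-5, a `354 × 354` matrix with ≈ 4 non-zeros per row tabulated from a function): one
118-row window ≈ 84 s of kernel; all 354 rows in one `eqCheck` do not finish in one decide.
[cite: BarrettEtAl1994, §4.3.1 «Compressed Row Storage (CRS)», p. 57] -/
theorem matrixOfSparseRows_eq_of_eqCheck_windows {m : ℕ} (n len k : ℕ) (hk : m ≤ k * len)
    {A B : SMat R}
    (h : ∀ t : Fin k, eqCheck len (A.drop (t.val * len)) (B.drop (t.val * len)) = true) :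
    matrixOfSparseRows m n A = matrixOfSparseRows m n B :=
  Matrix.ext fun i j => by
    have hi : i.val < k * len := lt_of_lt_of_le i.isLt hk
    have hlen : 0 < len := Nat.pos_of_ne_zero fun h0 => by simp [h0] at hi
    have ht : i.val / len < k := (Nat.div_lt_iff_lt_mul hlen).2 hi
    have h1 : i.val / len * len ≤ i.val := Nat.div_mul_le_self _ _
    have h2 : i.val < i.val / len * len + len := Nat.lt_div_mul_add hlen
    have hw := fn_eq_of_eqCheck (h ⟨i.val / len, ht⟩) (i.val - i.val / len * len) (by omega) j.val
    rw [getD_drop_sub A h1, getD_drop_sub B h1] at hw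
    rw [matrixOfSparseRows_apply, matrixOfSparseRows_apply]
    exact hw

end Check

section CheckOfFn

variable [CommRing R] [DecidableEq R]

/-- **A function-typed matrix presented by a row literal, in windows**: `Matrix.of f` equals the
literal's matrix once every window of the tabulation `ofFn m n f` checks against the literal.
[cite: BarrettEtAl1994, §4.3.1 «Compressed Row Storage (CRS)», p. 57] -/
theorem of_eq_matrixOfSparseRows_of_eqCheck_windows {m : ℕ} (n len k : ℕ)
    (hk : m ≤ k * len) (f : Fin m → Fin n → R) {B : SMat R}
    (h : ∀ t : Fin k, eqCheck len ((ofFn m n f).drop (t.val * len)) (B.drop (t.val * len)) = true) :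
    Matrix.of f = matrixOfSparseRows m n B := by
  rw [← matrixOfSparseRows_ofFn m n f]
  exact matrixOfSparseRows_eq_of_eqCheck_windows n len k hk h

end CheckOfFn

/-! ### Transpose (entries re-keyed by column, radix-grouped) -/

section Transpose

variable [AddCommMonoid R]

/-- Column-keyed packets `(j, (i, v))` of the first `m` rows (row counter `i`). [cite: BarrettEtAl1994, §4.3.1 (CCS is CRS of Aᵀ), p. 57] -/
def tpackets : ℕ → ℕ → SMat R → List (ℕ × (ℕ × R))
  | _, 0, _ => []
  | _, _ + 1, [] => []
  | i, m + 1, r :: A => r.map (fun p => (p.1, (i, p.2))) ++ tpackets (i + 1) m A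

/-- One row's contribution to the bucket of column `j` (plumbing). [folklore] -/
private theorem fn_bucket_row (r : SRow R) (i₀ j i : ℕ) :
    SRow.fn (((r.map fun p => (p.1, (i₀, p.2))).filter fun p => decide (p.1 = j)).map Prod.snd) i
      = if i₀ = i then SRow.fn r j else 0 := by
  induction r with
  | nil => simp
  | cons p r ih =>
    obtain ⟨j', v⟩ := p
    simp only [List.map_cons, List.filter_cons] at ih ⊢
    by_cases hj : j' = j
    · subst hj
      simp only [decide_true, if_true, List.map_cons, SRow.fn_cons, ih]
      by_cases hi : i₀ = i
      · simp [hi]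
      · simp [hi]
    · simp only [hj, decide_false, Bool.false_eq_true, if_false, ih, SRow.fn_cons, zero_add]

/-- The bucket of column `j`, read at row index `i`, is `A[i][j]` for the rows counted.
[cite: BarrettEtAl1994, §4.3.1 (CCS is CRS of Aᵀ), p. 57] -/
theorem fn_bucket_tpackets (i₀ m : ℕ) (A : SMat R) (j i : ℕ) :
    SRow.fn (((tpackets i₀ m A).filter fun p => decide (p.1 = j)).map Prod.snd) i
      = if i₀ ≤ i ∧ i < i₀ + m then SRow.fn (A.getD (i - i₀) []) j else 0 := by
  induction m generalizing i₀ A with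
  | zero => simp [tpackets]
  | succ m ih =>
    cases A with
    | nil => simp [tpackets]
    | cons r A =>
      rw [tpackets, List.filter_append, List.map_append, SRow.fn_append, fn_bucket_row, ih]
      rcases Nat.lt_trichotomy i i₀ with hlt | heq | hgt
      · rw [if_neg (by omega), if_neg (by omega), if_neg (by omega), add_zero]
      · subst heq
        rw [if_pos rfl, if_neg (by omega), if_pos ⟨le_rfl, by omega⟩, Nat.sub_self,
          List.getD_cons_zero, add_zero]
      · rw [if_neg (by omega), zero_add]
        by_cases h : i < i₀ + (m + 1)
        · rw [if_pos ⟨by omega, by omega⟩, if_pos ⟨by omega, h⟩,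
            show i - i₀ = (i - (i₀ + 1)) + 1 by omega, List.getD_cons_succ]
        · rw [if_neg (by omega), if_neg (by omega)]

/-- **Transpose** of the first `m` rows, as `2 ^ d` rows (one per column `< 2 ^ d`).
[cite: BarrettEtAl1994, §4.3.1 (CCS is CRS of Aᵀ), p. 57] -/
def transpose (d m : ℕ) (A : SMat R) : SMat R := radix d 0 (tpackets 0 m A)

/-- **Law of `transpose`**: for `n ≤ 2 ^ d` columns, `transpose d m A` read as an `n × m` matrix is
the transpose of `A` read as an `m × n` matrix. [cite: BarrettEtAl1994, §4.3.1 (CCS is CRS of Aᵀ), p. 57] -/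
theorem matrixOfSparseRows_transpose {d n : ℕ} (m : ℕ) (hn : n ≤ 2 ^ d) (A : SMat R) :
    matrixOfSparseRows n m (transpose d m A) = (matrixOfSparseRows m n A)ᵀ := by
  ext j i
  rw [matrixOfSparseRows_apply, Matrix.transpose_apply, matrixOfSparseRows_apply, transpose,
    getD_radix _ _ _ (lt_of_lt_of_le j.isLt hn), Nat.zero_add, fn_bucket_tpackets,
    if_pos ⟨Nat.zero_le _, by simp⟩, Nat.sub_zero]

end Transpose

/-! ### The transposed product `Atᵀ * B` (outer products re-keyed by output row) -/

section MulT

variable [CommRing R]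

/-- Packets of `Atᵀ * B` keyed by output row: for `k < n`, every entry `(i, a)` of row `k` of
`At` contributes `(i, a • row k of B)`. [cite: BarrettEtAl1994, §4.3.2 «CRS Matrix-Vector Product» and the transpose product y = Aᵀx by index switching, pp. 61–62] -/
def mpackets : ℕ → SMat R → SMat R → List (ℕ × SRow R)
  | 0, _, _ => []
  | k + 1, At, B =>
    (At.headD []).map (fun p => (p.1, SRow.scale p.2 (B.headD []))) ++ mpackets k At.tail B.tail

/-- One outer-product row's contribution (plumbing). [folklore] -/
private theorem sum_outer_row (c r : SRow R) (i j : ℕ) :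
    (((c.map fun p => (p.1, SRow.scale p.2 r)).filter fun p => decide (p.1 = i)).map
        fun p => SRow.fn p.2 j).sum = SRow.fn c i * SRow.fn r j := by
  induction c with
  | nil => simp
  | cons p c ih =>
    obtain ⟨i', a⟩ := p
    simp only [List.map_cons, List.filter_cons] at ih ⊢
    by_cases hi : i' = i
    · subst hi
      simp only [decide_true, if_true, List.map_cons, List.sum_cons, ih, SRow.fn_scale, SRow.fn_cons]
      ring
    · simp only [hi, decide_false, Bool.false_eq_true, if_false, ih, SRow.fn_cons, zero_add]

/-- The packets with output row `i` sum, at column `j`, to `Σ_{k<n} At[k][i] · B[k][j]`. [cite: BarrettEtAl1994, §4.3.2 «CRS Matrix-Vector Product» and the transpose product y = Aᵀx by index switching, pp. 61–62] -/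
theorem sum_mpackets (n : ℕ) (At B : SMat R) (i j : ℕ) :
    (((mpackets n At B).filter fun p => decide (p.1 = i)).map fun p => SRow.fn p.2 j).sum
      = ∑ k : Fin n, SRow.fn (At.getD k.val []) i * SRow.fn (B.getD k.val []) j := by
  induction n generalizing At B with
  | zero => simp [mpackets]
  | succ n ih =>
    rw [mpackets, List.filter_append, List.map_append, List.sum_append, sum_outer_row, ih,
      Fin.sum_univ_succ]
    congr 1
    · cases At <;> cases B <;> simp
    · refine Finset.sum_congr rfl fun k _ => ?_
      cases At <;> cases B <;> simp

/-- **Transposed product** `Atᵀ * B` over the first `n` rows of both, as `2 ^ d` output rows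
(each the merge-sum of its packets). [cite: BarrettEtAl1994, §4.3.2 «CRS Matrix-Vector Product» and the transpose product y = Aᵀx by index switching, pp. 61–62] -/
def mulT (d n : ℕ) (At B : SMat R) : SMat R :=
  (radix d 0 (mpackets n At B)).map SRow.sumRows

/-- **Law of `mulT`**: for `m ≤ 2 ^ d`, `mulT d n At B` read as `m × p` is
`(At as n × m)ᵀ * (B as n × p)`. [cite: BarrettEtAl1994, §4.3.2 «CRS Matrix-Vector Product» and the transpose product y = Aᵀx by index switching, pp. 61–62] -/
theorem matrixOfSparseRows_mulT {d m : ℕ} (n p : ℕ) (hm : m ≤ 2 ^ d) (At B : SMat R) :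
    matrixOfSparseRows m p (mulT d n At B)
      = (matrixOfSparseRows n m At)ᵀ * matrixOfSparseRows n p B := by
  ext i j
  rw [matrixOfSparseRows_apply, Matrix.mul_apply, mulT,
    show ([] : SRow R) = SRow.sumRows [] from rfl, List.getD_map,
    getD_radix _ _ _ (lt_of_lt_of_le i.isLt hm), Nat.zero_add, SRow.fn_sumRows, List.map_map]
  simp only [Matrix.transpose_apply, matrixOfSparseRows_apply]
  rw [← sum_mpackets]
  rfl

/-- **Product** `A * B` := `mulT (transpose A) B`. [cite: BarrettEtAl1994, §4.3.2 «CRS Matrix-Vector Product» and the transpose product y = Aᵀx by index switching, pp. 61–62] -/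
def mul (dm dn m n : ℕ) (A B : SMat R) : SMat R := mulT dm n (transpose dn m A) B

/-- **Law of `mul`**: for `m ≤ 2 ^ dm`, `n ≤ 2 ^ dn`. [cite: BarrettEtAl1994, §4.3.2 «CRS Matrix-Vector Product» and the transpose product y = Aᵀx by index switching, pp. 61–62] -/
theorem matrixOfSparseRows_mul {dm dn m n : ℕ} (p : ℕ) (hm : m ≤ 2 ^ dm) (hn : n ≤ 2 ^ dn)
    (A B : SMat R) :
    matrixOfSparseRows m p (mul dm dn m n A B)
      = matrixOfSparseRows m n A * matrixOfSparseRows n p B := by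
  rw [mul, matrixOfSparseRows_mulT n p hm, matrixOfSparseRows_transpose m hn, Matrix.transpose_transpose]

end MulT

/-! ### Block assembly -/

section Blocks

variable [AddCommMonoid R]

/-- **Horizontal concatenation** `[A B]` with `A` occupying the columns `< n₁` (entries of `A` at
columns `≥ n₁` are dropped, `B` is shifted by `n₁`). [cite: BarrettEtAl1994, §4.3.1 «Compressed Row Storage (CRS)», p. 57] -/
def hcat (n₁ : ℕ) (A B : SMat R) : SMat R :=
  zipRows (fun a b => SRow.takeCols n₁ a ++ SRow.shift n₁ b) A B

/-- Rows of `hcat`. [cite: BarrettEtAl1994, §4.3.1 «Compressed Row Storage (CRS)», p. 57] -/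
theorem fn_hcat (n₁ : ℕ) (A B : SMat R) (i j : ℕ) :
    SRow.fn ((hcat n₁ A B).getD i []) j
      = if j < n₁ then SRow.fn (A.getD i []) j else SRow.fn (B.getD i []) (j - n₁) := by
  rw [hcat, getD_zipRows (by rfl), SRow.fn_append, SRow.fn_takeCols, SRow.fn_shift]
  by_cases h : j < n₁
  · rw [if_pos h, if_neg (by omega), if_pos h, add_zero]
  · rw [if_neg h, if_pos (by omega), if_neg h, zero_add]

/-- Exactly `m` rows of `A` (padded with empty rows). [cite: BarrettEtAl1994, §4.3.1 «Compressed Row Storage (CRS)», p. 57] -/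
def takePad : ℕ → SMat R → SMat R
  | 0, _ => []
  | k + 1, A => A.headD [] :: takePad k A.tail

omit [AddCommMonoid R] in
/-- `takePad m A` has length `m`. [folklore] -/
private theorem length_takePad : ∀ (m : ℕ) (A : SMat R), (takePad m A).length = m
  | 0, _ => rfl
  | k + 1, A => by rw [takePad, List.length_cons, length_takePad k]

omit [AddCommMonoid R] in
/-- Rows of `takePad`. [folklore] -/
private theorem getD_takePad : ∀ (m : ℕ) (A : SMat R) (i : ℕ), i < m → (takePad m A).getD i [] = A.getD i []
  | 0, _, i, h => absurd h (Nat.not_lt_zero i)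
  | k + 1, A, 0, _ => by cases A <;> simp [takePad]
  | k + 1, A, i + 1, h => by
    rw [takePad, List.getD_cons_succ, getD_takePad k _ i (by omega)]
    cases A <;> simp

/-- **Vertical concatenation** `[A; C]` with `A` occupying exactly the rows `< m₁`. [cite: BarrettEtAl1994, §4.3.1 «Compressed Row Storage (CRS)», p. 57] -/
def vcat (m₁ : ℕ) (A C : SMat R) : SMat R := takePad m₁ A ++ C

omit [AddCommMonoid R] in
/-- Rows of `vcat`. [cite: BarrettEtAl1994, §4.3.1 «Compressed Row Storage (CRS)», p. 57] -/
theorem getD_vcat (m₁ : ℕ) (A C : SMat R) (i : ℕ) :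
    (vcat m₁ A C).getD i [] = if i < m₁ then A.getD i [] else C.getD (i - m₁) [] := by
  rw [vcat]
  by_cases h : i < m₁
  · rw [if_pos h, List.getD_append _ _ _ _ (by rw [length_takePad]; exact h), getD_takePad _ _ _ h]
  · rw [if_neg h, List.getD_append_right _ _ _ _ (by rw [length_takePad]; omega), length_takePad]

/-- **Block matrix** `[A B; C D]` with `A` of size `m₁ × n₁`. [cite: BarrettEtAl1994, §4.3.1 «Compressed Row Storage (CRS)», p. 57] -/
def fromBlocks (m₁ n₁ : ℕ) (A B C D : SMat R) : SMat R := vcat m₁ (hcat n₁ A B) (hcat n₁ C D)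

/-- **Law of `fromBlocks`**: `Matrix.fromBlocks` of the four blocks, re-indexed from
`Fin m₁ ⊕ Fin m₂` / `Fin n₁ ⊕ Fin n₂` to `Fin (m₁ + m₂)` / `Fin (n₁ + n₂)` by `finSumFinEquiv`.
[cite: BarrettEtAl1994, §4.3.1 «Compressed Row Storage (CRS)», p. 57] -/
theorem matrixOfSparseRows_fromBlocks (m₁ m₂ n₁ n₂ : ℕ) (A B C D : SMat R) :
    matrixOfSparseRows (m₁ + m₂) (n₁ + n₂) (fromBlocks m₁ n₁ A B C D)
      = (Matrix.fromBlocks (matrixOfSparseRows m₁ n₁ A) (matrixOfSparseRows m₁ n₂ B)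
          (matrixOfSparseRows m₂ n₁ C) (matrixOfSparseRows m₂ n₂ D)).submatrix
          finSumFinEquiv.symm finSumFinEquiv.symm := by
  ext i j
  rw [matrixOfSparseRows_apply, fromBlocks, getD_vcat, Matrix.submatrix_apply]
  induction i using Fin.addCases with
  | left i =>
    rw [finSumFinEquiv_symm_apply_castAdd, Fin.val_castAdd, if_pos i.isLt, fn_hcat]
    induction j using Fin.addCases with
    | left j =>
      rw [finSumFinEquiv_symm_apply_castAdd, Matrix.fromBlocks_apply₁₁, Fin.val_castAdd,
        if_pos j.isLt, matrixOfSparseRows_apply]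
    | right j =>
      rw [finSumFinEquiv_symm_apply_natAdd, Matrix.fromBlocks_apply₁₂, Fin.val_natAdd,
        if_neg (by omega), matrixOfSparseRows_apply, Nat.add_sub_cancel_left]
  | right i =>
    rw [finSumFinEquiv_symm_apply_natAdd, Fin.val_natAdd, if_neg (by omega),
      Nat.add_sub_cancel_left, fn_hcat]
    induction j using Fin.addCases with
    | left j =>
      rw [finSumFinEquiv_symm_apply_castAdd, Matrix.fromBlocks_apply₂₁, Fin.val_castAdd,
        if_pos j.isLt, matrixOfSparseRows_apply]
    | right j =>
      rw [finSumFinEquiv_symm_apply_natAdd, Matrix.fromBlocks_apply₂₂, Fin.val_natAdd,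
        if_neg (by omega), matrixOfSparseRows_apply, Nat.add_sub_cancel_left]

end Blocks

/-! ### Kernel-checked examples -/

section Examples

/-- `A = [[1,2],[0,3]]`, `B = [[4,0],[5,6]]` as sparse rows: `Aᵀ B`, `A B`, `A + B`, `A − B`,
`2 • A`, `Aᵀ`, the block matrix `[A B; 0 diag(7,8)]`, all decided against dense literals
(test data). [folklore] -/
private def exA : SMat ℚ := [[(0, 1), (1, 2)], [(1, 3)]]
/-- Test datum `B`. [folklore] -/
private def exB : SMat ℚ := [[(0, 4)], [(0, 5), (1, 6)]]

example : matrixOfSparseRows 2 2 (mulT 1 2 exA exB) = !![4, 0; 23, 18] := by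
  rw [show (!![4, 0; 23, 18] : Matrix (Fin 2) (Fin 2) ℚ) = matrixOfRows 2 2 [[4, 0], [23, 18]] from
    (matrixOfRows_eq_of_forall (by decide)).symm, ← matrixOfSparseRows_ofDense]
  exact matrixOfSparseRows_eq_of_eqCheck 2 (by decide +kernel)

example : (matrixOfSparseRows 2 2 exA)ᵀ * matrixOfSparseRows 2 2 exB = !![4, 0; 23, 18] := by
  rw [← matrixOfSparseRows_mulT 2 2 (d := 1) (by norm_num)]
  ext i j; fin_cases i <;> fin_cases j <;> decide +kernel

example : matrixOfSparseRows 2 2 exA * matrixOfSparseRows 2 2 exB = !![14, 12; 15, 18] := by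
  rw [← matrixOfSparseRows_mul 2 (dm := 1) (dn := 1) (by norm_num) (by norm_num)]
  ext i j; fin_cases i <;> fin_cases j <;> decide +kernel

example : matrixOfSparseRows 2 2 exA + matrixOfSparseRows 2 2 exB
    - (2 : ℚ) • (matrixOfSparseRows 2 2 exA)ᵀ = !![3, 2; 1, 3] := by
  rw [← matrixOfSparseRows_add, ← matrixOfSparseRows_transpose 2 (d := 1) (by norm_num),
    ← matrixOfSparseRows_smul, ← matrixOfSparseRows_sub]
  ext i j; fin_cases i <;> fin_cases j <;> decide +kernel

example : matrixOfSparseRows 4 4 (fromBlocks 2 2 exA exB [] (diagonal [(7 : ℚ), 8]))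
    = matrixOfRows 4 4 [[1, 2, 4, 0], [0, 3, 5, 6], [0, 0, 7, 0], [0, 0, 0, 8]] := by
  rw [← matrixOfSparseRows_ofDense]
  exact matrixOfSparseRows_eq_of_eqCheck 4 (by decide +kernel)

/-- The semantic side of the block example: `Matrix.fromBlocks` re-indexed. -/
example : matrixOfSparseRows (2 + 2) (2 + 2) (fromBlocks 2 2 exA exB [] (diagonal [(7 : ℚ), 8]))
    = (Matrix.fromBlocks (matrixOfSparseRows 2 2 exA) (matrixOfSparseRows 2 2 exB)
        (0 : Matrix (Fin 2) (Fin 2) ℚ) (Matrix.diagonal ![7, 8])).submatrix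
        finSumFinEquiv.symm finSumFinEquiv.symm := by
  rw [matrixOfSparseRows_fromBlocks, matrixOfSparseRows_diagonal]
  have h0 : matrixOfSparseRows 2 2 ([] : SMat ℚ) = 0 := by
    ext i j; fin_cases i <;> fin_cases j <;> rfl
  have h1 : (fun i : Fin 2 => [(7 : ℚ), 8].getD i.val 0) = ![7, 8] := by
    funext i; fin_cases i <;> rfl
  rw [h0, h1]

/-- Row scaling: `diag(2, 3) * A`. -/
example : Matrix.diagonal ![(2 : ℚ), 3] * matrixOfSparseRows 2 2 exA = !![2, 4; 0, 9] := by
  have h := matrixOfSparseRows_scaleRows 2 2 [(2 : ℚ), 3] exA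
  have hd : (fun i : Fin 2 => [(2 : ℚ), 3].getD i.val 0) = ![2, 3] := by
    funext i; fin_cases i <;> rfl
  rw [hd] at h
  rw [← h]
  ext i j; fin_cases i <;> fin_cases j <;> decide +kernel

/-- A typed (function) matrix against a sparse literal. -/
example : (!![1, 2; 0, 3] : Matrix (Fin 2) (Fin 2) ℚ) = matrixOfSparseRows 2 2 exA := by
  have h := matrixOfSparseRows_eq_of_eqCheck 2 (m := 2)
    (A := ofFn 2 2 (!![1, 2; 0, 3] : Matrix (Fin 2) (Fin 2) ℚ)) (B := exA) (by decide +kernel)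
  rwa [matrixOfSparseRows_ofFn] at h

/-- A refusal. -/
example : eqCheck 2 (mulT 1 2 exA exB) (ofDense [[4, 0], [23, (17 : ℚ)]]) = false := by
  decide +kernel

/-- The LMI-shaped usage: `−(AᵀP + PA + ε·1)` assembled from sparse literals, its identity with a
target literal decided by `eqCheck`, and the matrix statement recovered through the laws
(`A = exA`, `P = exB`, `ε = 1/2`). -/
example : -((matrixOfSparseRows 2 2 exA)ᵀ * matrixOfSparseRows 2 2 exB
      + matrixOfSparseRows 2 2 exB * matrixOfSparseRows 2 2 exA
      + (1 / 2 : ℚ) • (1 : Matrix (Fin 2) (Fin 2) ℚ))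
    = matrixOfRows 2 2 [[-17/2, -8], [-28, -93/2]] := by
  rw [← matrixOfSparseRows_mulT 2 2 (d := 1) (by norm_num),
    ← matrixOfSparseRows_mul 2 (dm := 1) (dn := 1) (by norm_num) (by norm_num),
    ← matrixOfSparseRows_add, ← matrixOfSparseRows_scalar, ← matrixOfSparseRows_add,
    ← matrixOfSparseRows_neg, ← matrixOfSparseRows_ofDense]
  exact matrixOfSparseRows_eq_of_eqCheck 2 (by decide +kernel)

/-! #### The FUSED shape: a block LMI's identity with its clique decomposition, no big literal

`M = [−(AᵀP + PA), −PB; −(PB)ᵀ, diag τ]` for `A = [[0,1],[−2,−3]]`, `P = [[2,1],[1,2]]`,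
`B = [[3,1],[1,−2]]`, `τ = (5, 7)`, assembled as an `SMat` EXPRESSION from the sparse literals of
`A`, `P`, `B`, and checked DIRECTLY against a two-clique decomposition (`{0,1,2}`, `{1,2,3}`) by
`cliqueSweepS` — the sweep evaluates the expression's rows lazily; the matrix statement follows from
the laws. This is the template for a clique-decomposed Lyapunov LMI row: no literal of `M` exists in
any file. -/

/-- Test datum `A`. [folklore] -/
private def toyA : SMat ℚ := [[(1, 1)], [(0, -2), (1, -3)]]
/-- Test datum `P`. [folklore] -/
private def toyP : SMat ℚ := [[(0, 2), (1, 1)], [(0, 1), (1, 2)]]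
/-- Test datum `B`. [folklore] -/
private def toyB : SMat ℚ := [[(0, 3), (1, 1)], [(0, 1), (1, -2)]]
/-- `−(AᵀP + PA)` as an expression. [folklore] -/
private def toyL11 : SMat ℚ := neg (add (mulT 1 2 toyA toyP) (mul 1 1 2 2 toyP toyA))
/-- `−PB` as an expression. [folklore] -/
private def toyL12 : SMat ℚ := neg (mul 1 1 2 2 toyP toyB)
/-- The block matrix `M` as an expression. [folklore] -/
private def toyM : SMat ℚ := fromBlocks 2 2 toyL11 toyL12 (transpose 1 2 toyL12) (diagonal [5, 7])
/-- Its two-clique decomposition (test data). [folklore] -/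
private def toyBlocks : List (Block (2 + 2) ℚ) :=
  [⟨[0, 1, 2], !![4, 5, -7; 5, 5, -5/2; -7, -5/2, 5/2]⟩, ⟨[1, 2, 3], !![5, -5/2, 3; -5/2, 5/2, 0; 3, 0, 7]⟩]

/-- The fused check: expression rows against the clique sum, one decide. -/
example : cliqueSweepS (2 + 2) 0 (2 + 2) toyM toyBlocks = true := by
  decide +kernel

/-- … and the matrix statement it proves, through the laws. -/
example : (Matrix.fromBlocks
      (-((matrixOfSparseRows 2 2 toyA)ᵀ * matrixOfSparseRows 2 2 toyP
          + matrixOfSparseRows 2 2 toyP * matrixOfSparseRows 2 2 toyA))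
      (-(matrixOfSparseRows 2 2 toyP * matrixOfSparseRows 2 2 toyB))
      (-(matrixOfSparseRows 2 2 toyP * matrixOfSparseRows 2 2 toyB))ᵀ
      (Matrix.diagonal ![(5 : ℚ), 7])).submatrix finSumFinEquiv.symm finSumFinEquiv.symm
    = blockSum toyBlocks := by
  have h : matrixOfSparseRows (2 + 2) (2 + 2) toyM = blockSum toyBlocks :=
    matrixOfSparseRows_eq_blockSum' (by decide +kernel)
  have hd : (fun i : Fin 2 => [(5 : ℚ), 7].getD i.val 0) = ![5, 7] := by
    funext i; fin_cases i <;> rfl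
  rw [toyM, matrixOfSparseRows_fromBlocks, matrixOfSparseRows_transpose 2 (by norm_num), toyL11,
    toyL12, matrixOfSparseRows_neg, matrixOfSparseRows_neg, matrixOfSparseRows_add,
    matrixOfSparseRows_mulT 2 2 (by norm_num), matrixOfSparseRows_mul 2 (by norm_num) (by norm_num),
    matrixOfSparseRows_mul 2 (by norm_num) (by norm_num), matrixOfSparseRows_diagonal, hd] at h
  exact h

/-- Row-window presentation: a `3 × 2` function-typed matrix against its row literal in two windows of
two rows (`3 ≤ 2·2`); the dropped rows of the tabulation are never evaluated. -/
example : Matrix.of (fun (i : Fin 3) (j : Fin 2) => ((i.val + 2 * j.val : ℕ) : ℚ))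
    = matrixOfSparseRows 3 2 [[(1, 2)], [(0, 1), (1, 3)], [(0, 2), (1, (4 : ℚ))]] :=
  of_eq_matrixOfSparseRows_of_eqCheck_windows 2 2 2 (by norm_num) _
    (fun t => by fin_cases t <;> decide +kernel)

end Examples

end SMat

end PSD

end Literature.Computation.Certificates
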